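import Summits.CriticalPhenomena.PercolationContinuityZ3.Theorems.PercNearOneGluingNoHeavyLowerTailTIncSwitchingMaps
import Summits.CriticalPhenomena.PercolationContinuityZ3.Theorems.PercNearOneGluingNoHeavyLowerTailTIncSwitchingCertificate
import Summits.CriticalPhenomena.PercolationContinuityZ3.Theorems.PercNearOneGluingNoHeavyLowerTailTIncRowPartial
import Summits.CriticalPhenomena.PercolationContinuityZ3.Theorems.PercNearOneGluingNoHeavyLowerTailCoSunflowerRows
import Mathlib.Tactic.Ring
import Mathlib.Tactic.Linarith
import HarnessLib

/-!
# `NoHeavyLowerTail` (stmt-CriticalPhenomena-4575) — THEOREM `T_inc`: Sahi's `C₃` on the three INCREASING events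
# "`a` (resp. `b`, `c`) is joined to another terminal" holds on EVERY finite weighted graph (five-switching proof), III

Support file (prover prim-e3grp-switch-1; `--supports stmt-CriticalPhenomena-4575`).  No named facts, no sorries.

**Theorem** (`tIncRow_holds : TIncRow`, the `Prop` of `…CoSunflowerRows`).  For Bernoulli bond percolation `prodBernoulli w` with
arbitrary edge weights on a finite vertex type and any vertices `a b c`:
`0 ≤ E₃({a↔b}∪{a↔c}, {a↔b}∪{b↔c}, {a↔c}∪{b↔c})`, equivalently (`TIncRow.sahiE3_nonIsol_eq`) the five-cell inequality
`T_inc = (1+q)(qt − e₂(u)) − e₃(u) ≥ 0` — the increasing dual of `3PT-LB = (1+t)(qt − e₂(u)) − e₃(u) ≥ 0`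
(`ThreePointLB.sahiE3_pairSep_nonneg`); by prim-ineq-prove-2's classification these two are the only 3-point Sahi triples not implied
by Harris + Aas–Gladkov, so with this file Sahi's `C₃` / [Kahn2022, Conj. 5] holds for every triple of same-direction monotone events of
the three-point connectivity type.  `T_inc` is also the `y`-isolated face of the open four-point E3GRP classes `γ`, `α` and the
`c = y` face of `β`.  Previously in the tree only for `n ≤ 5` (`SahiIncRows.tInc_le_five`) and for `μ(abc) ≤ μ(a|b|c)` (`…TIncRowPartial`).

**Proof** (prim-e3grp-switch-1, PROOF-TINC.md, certificate "I5" found by the extended switching LP, kit j081908, 2026-08-20).  Three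
independent copies `X, Y, Z`; five measure-preserving switchings exploring copy `X`: `Ψ₁ = phi2 a` (`a→Z`), `Ψ₂ = phi2 c` (`c→Z`),
the REVEAL-ONLY programs `Ψ₃ = psi3 a c` (`a` revealed, then `c→Z`) and `Ψ₄ = psi4 b c` (`b` revealed, then `c→Y`) of file I, and
`Ψ₅ = phi3 c a` (`c→Y; a→Z`); ±1 potentials on box events including the feature "`a ≁ b` in the `X`-output" (`certI5`); POINTWISE
`S = λ₀ + Σ λᵢ∘Ψᵢ ≤ 0` (`certI5_nonpos`: the sealed-cluster facts rewrite everything into nineteen atoms, the cluster lemmas of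
`…ThreePointLBSwitchingClusters` give twenty implications, and the finite check is `certP_nonpos` of file II); `E[S] = −T_inc`
(`sum_wt3W_certI5`, `cert_identity`).  Hence `T_inc = −E[S] ≥ 0`.  What is new relative to 3PT-LB: no exchange-only three-copy
certificate exists for `T_inc` (switch-1 no-go, LP infeasible on real configurations); the reveal-only regions of
[GladkovZimin2024, Thm. 4.6] together with one `o_X`-feature make three copies suffice.
-/

noncomputable section

namespace Summit.CriticalPhenomena.PercolationContinuityZ3.Theorems

namespace TIncSwitching

open Finset Literature.Probability.Percolation Literature.Probability.Percolation.DecisionTree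
open Literature.Probability.Percolation.Gladkov ThreePointLB
open scoped Classical

variable {V : Type*} [Fintype V] [DecidableEq V]

/-! ### The potentials and the pointwise certificate -/

section Cert

variable (a b c : V)

/-- The pointwise certificate `S(x) = λ₀(x) + Σᵢ λᵢ(Ψᵢ x)` of PROOF-TINC.md (certificate I5), potentials as ±indicators of box events
(`Q = a|b|c = (ab)ᶜ∩(ac)ᶜ∩(bc)ᶜ`, `Pa = bc∩(ab)ᶜ`, `Pb = ac∩(ab)ᶜ`, `Pc = ab∩(ac)ᶜ`, `a iso = (ab)ᶜ∩(ac)ᶜ`, `b iso = (ab)ᶜ∩(bc)ᶜ`):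
`λ₁(o) = −[o₁ ∉ Pb][o₂ ∈ Q] − [o₁: a iso][o₂ ∈ Pa]` on `Ψ₁ = phi2 a`;  `λ₂(o) = [o₀: a≁b][o₁: a iso][o₂ ∈ Pc]` on `Ψ₂ = phi2 c`;
`λ₃(o) = [o₀: a≁b][o₁: a iso][o₂: b iso]` on `Ψ₃ = psi3 a c`;  `λ₄(o) = [o₀: a≁b][o₁: a iso][o₂: b≁c]` on `Ψ₄ = psi4 b c`;
`λ₅(o) = [o₁ ∈ Pc][o₂: b iso]` on `Ψ₅ = phi3 c a`;
`λ₀ = [X∈Pa][Y: a~b][Z: b≁c] + [X∈Pa][Y: a iso][Z: b~c] − [X∈Pb][Y: a iso][Z: b iso] − [X∈Q][Y: a≁b][Z: b≁c]`. [this work] -/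
def certI5 (x : Fin 3 → Finset (Sym2 V)) : ℝ :=
  - ind (box Set.univ (conn a c ∩ (conn a b)ᶜ)ᶜ ((conn a b)ᶜ ∩ ((conn a c)ᶜ ∩ (conn b c)ᶜ))) (phi2 a x)
  - ind (box Set.univ ((conn a b)ᶜ ∩ (conn a c)ᶜ) (conn b c ∩ (conn a b)ᶜ)) (phi2 a x)
  + ind (box (conn a b)ᶜ ((conn a b)ᶜ ∩ (conn a c)ᶜ) (conn a b ∩ (conn a c)ᶜ)) (phi2 c x)
  + ind (box (conn a b)ᶜ ((conn a b)ᶜ ∩ (conn a c)ᶜ) ((conn a b)ᶜ ∩ (conn b c)ᶜ)) (psi3 a c x)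
  + ind (box (conn a b)ᶜ ((conn a b)ᶜ ∩ (conn a c)ᶜ) (conn b c)ᶜ) (psi4 b c x)
  + ind (box Set.univ (conn a b ∩ (conn a c)ᶜ) ((conn a b)ᶜ ∩ (conn b c)ᶜ)) (phi3 c a x)
  + ind (box (conn b c ∩ (conn a b)ᶜ) (conn a b) (conn b c)ᶜ) x
  + ind (box (conn b c ∩ (conn a b)ᶜ) ((conn a b)ᶜ ∩ (conn a c)ᶜ) (conn b c)) x
  - ind (box (conn a c ∩ (conn a b)ᶜ) ((conn a b)ᶜ ∩ (conn a c)ᶜ) ((conn a b)ᶜ ∩ (conn b c)ᶜ)) x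
  - ind (box ((conn a b)ᶜ ∩ ((conn a c)ᶜ ∩ (conn b c)ᶜ)) (conn a b)ᶜ (conn b c)ᶜ) x

end Cert

/-! ### Two more cluster facts -/

/-- **(F3′)** If the exchanged region `F` contains no pair meeting `cl X u`, the `X`-cluster of `u` survives in
`ω on F, X elsewhere`. [this work] -/
theorem cl_subset_cl_splice_of_disjoint {F X ω : Finset (Sym2 V)} {u : V}
    (hF : ∀ e ∈ F, e ∉ touch (cl X u)) : cl X u ⊆ cl (splice F ω X) u := by
  intro u' hu'
  obtain ⟨w⟩ := mem_cl.1 hu'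
  refine mem_cl.2 (reachable_of_walk (C := cl X u) (fun y y' hy hyy' => mem_cl_of_adj hy hyy') ?_ w
    (mem_cl_self X u))
  intro y y' hy hyy'
  rw [adj_iff] at hyy' ⊢
  have he : s(y, y') ∉ F := fun h => hF _ h (mk_mem_touch.2 (Or.inl hy))
  exact ⟨(mem_splice_of_not_mem he).2 hyy'.1, hyy'.2⟩

/-- The region of a reveal-only program is empty when its exchange root lies in the revealed cluster. [this work] -/
theorem touch_sdiff_touch_eq_empty {X : Finset (Sym2 V)} {v c : V} (h : c ∈ cl X v) :
    touch (cl X c) \ touch (cl X v) = ∅ := by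
  rw [cl_eq_cl_of_mem h, Finset.sdiff_self]

/-! ### The pointwise lemma -/

/-- **Pointwise lemma** (PROOF-TINC.md, Lemma 2 / §HAND PROOF): for every graph and every triple `x = (X, Y, Z)`,
`S(x) = λ₀(x) + Σᵢ λᵢ(Ψᵢ x) ≤ 0`. [this work] -/
theorem certI5_nonpos (a b c : V) (x : Fin 3 → Finset (Sym2 V)) : certI5 a b c x ≤ 0 := by
  have hca : ∀ K : Finset (Sym2 V), a ∈ cl K c ↔ c ∈ cl K a := fun K => mem_cl_comm
  have hcb : ∀ K : Finset (Sym2 V), b ∈ cl K c ↔ c ∈ cl K b := fun K => mem_cl_comm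
  simp only [certI5, ind_eq_pind, mem_box, phi2_zero, phi2_one, phi2_two, phi3_zero, phi3_one, phi3_two,
    psi3_zero, psi3_one, psi3_two, psi4_zero, psi4_one, psi4_two, Set.mem_inter_iff, Set.mem_compl_iff,
    Set.mem_univ, true_and, mem_conn_iff_mem_cl, mem_cl_splice_touch_root, mem_cl_splice_touch_root']
  simp only [mem_cl_splice_touch_iff, hca, hcb]
  refine certP_nonpos _ _ _ _ _ _ _ _ _ _ _ _ _ _ _ _ _ _ _ ?_ ?_ ?_ ?_ ?_ ?_ ?_ ?_ ?_ ?_ ?_ ?_ ?_ ?_ ?_ ?_ ?_ ?_ ?_ ?_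
  · -- h1: transitivity in X
    exact fun hac hbc => mem_cl_trans hac (mem_cl_comm.1 hbc)
  · -- h2: a Y-path avoiding cl X c is a Y-path
    exact fun h => cl_mono Finset.sdiff_subset a h
  · -- h3
    exact fun h => cl_mono Finset.sdiff_subset b h
  · -- h4: F3 (the cluster of a survives when touch (cl X c) is overwritten, a ∉ cl X c)
    exact fun hac hab => cl_subset_cl_splice_touch_of_not_mem (fun h => hac ((hca _).1 h)) hab
  · -- h5: Ψ₃ is the identity when c ∈ cl X a
    intro hac; rw [touch_sdiff_touch_eq_empty hac, splice_empty]
  · intro hac; rw [touch_sdiff_touch_eq_empty hac, splice_empty]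
  · intro hac; rw [touch_sdiff_touch_eq_empty hac, splice_empty]
  · -- h8: F3′ for Ψ₃ (cl X a untouched)
    exact fun hac hab => cl_subset_cl_splice_of_disjoint (fun e he => (Finset.mem_sdiff.1 he).2) hab
  · -- h9: F4(i) for Ψ₃: cl X c stays connected
    exact fun hac hbc => mem_cl_comm.1 (cl_subset_cl_splice_sdiff hac (x 2) (mem_cl_comm.1 hbc))
  · -- h10: F4(ii) for Ψ₃
    exact fun h => cl_sdiff_touch_subset_cl_splice Finset.sdiff_subset a h
  · -- h11–h13: Ψ₄ is the identity when c ∈ cl X b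
    intro hbc; rw [touch_sdiff_touch_eq_empty hbc, splice_empty]
  · intro hbc; rw [touch_sdiff_touch_eq_empty hbc, splice_empty]
  · intro hbc; rw [touch_sdiff_touch_eq_empty hbc, splice_empty]
  · -- h14: F3′ for Ψ₄ (cl X a = cl X b untouched)
    intro hbc hab
    have hAB : cl (x 0) b = cl (x 0) a := cl_eq_cl_of_mem hab
    exact cl_subset_cl_splice_of_disjoint (fun e he => by rw [← hAB]; exact (Finset.mem_sdiff.1 he).2) hab
  · -- h15: F4(i) for Ψ₄
    exact fun hbc hac => mem_cl_comm.1 (cl_subset_cl_splice_sdiff hbc (x 1) ((hca _).2 hac))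
  · -- h16: F4(ii) for Ψ₄
    exact fun _ h => cl_sdiff_touch_subset_cl_splice Finset.sdiff_subset a h
  · -- h17: F4(i) for Ψ₅
    exact fun hac hab => cl_subset_cl_splice_sdiff (fun h => hac ((hca _).1 h)) (x 2) hab
  · -- h18: F4(ii) for Ψ₅
    exact fun h => cl_sdiff_touch_subset_cl_splice Finset.sdiff_subset b h
  · -- h19: a vertex reached avoiding cl X c is not in cl X c
    exact fun hac hkp hbc => not_mem_of_mem_cl_sdiff_touch (fun h => hac ((hca _).1 h)) hkp ((hcb _).2 hbc)
  · -- h20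
    exact fun hac hap hbc => not_mem_of_mem_cl_sdiff_touch (fun h => hac ((hca _).1 h)) hap ((hcb _).2 hbc)

/-! ### The expectation of the certificate is `−T_inc` -/

section Expectation

variable (p : Sym2 V → ℝ) (D : Finset (Sym2 V)) (a b c : V)

/-- `E[S] = Σ_i E[λ_i]`, each `E[λ_i ∘ Ψ_i] = E[λ_i]` by measure preservation and each `E[λ_i]` a product of three `PrW`'s. [this work] -/
theorem sum_wt3W_certI5 :
    ∑ x ∈ triples D, wt3W D p x * certI5 a b c x =
      - (PrW D p Set.univ * PrW D p (conn a c ∩ (conn a b)ᶜ)ᶜ * PrW D p ((conn a b)ᶜ ∩ ((conn a c)ᶜ ∩ (conn b c)ᶜ)))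
      - PrW D p Set.univ * PrW D p ((conn a b)ᶜ ∩ (conn a c)ᶜ) * PrW D p (conn b c ∩ (conn a b)ᶜ)
      + PrW D p (conn a b)ᶜ * PrW D p ((conn a b)ᶜ ∩ (conn a c)ᶜ) * PrW D p (conn a b ∩ (conn a c)ᶜ)
      + PrW D p (conn a b)ᶜ * PrW D p ((conn a b)ᶜ ∩ (conn a c)ᶜ) * PrW D p ((conn a b)ᶜ ∩ (conn b c)ᶜ)
      + PrW D p (conn a b)ᶜ * PrW D p ((conn a b)ᶜ ∩ (conn a c)ᶜ) * PrW D p (conn b c)ᶜ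
      + PrW D p Set.univ * PrW D p (conn a b ∩ (conn a c)ᶜ) * PrW D p ((conn a b)ᶜ ∩ (conn b c)ᶜ)
      + PrW D p (conn b c ∩ (conn a b)ᶜ) * PrW D p (conn a b) * PrW D p (conn b c)ᶜ
      + PrW D p (conn b c ∩ (conn a b)ᶜ) * PrW D p ((conn a b)ᶜ ∩ (conn a c)ᶜ) * PrW D p (conn b c)
      - PrW D p (conn a c ∩ (conn a b)ᶜ) * PrW D p ((conn a b)ᶜ ∩ (conn a c)ᶜ) * PrW D p ((conn a b)ᶜ ∩ (conn b c)ᶜ)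
      - PrW D p ((conn a b)ᶜ ∩ ((conn a c)ᶜ ∩ (conn b c)ᶜ)) * PrW D p (conn a b)ᶜ * PrW D p (conn b c)ᶜ := by
  have h1 : ∀ E₀ E₁ E₂ : Set (Finset (Sym2 V)),
      ∑ x ∈ triples D, wt3W D p x * ind (box E₀ E₁ E₂) (phi2 a x) = PrW D p E₀ * PrW D p E₁ * PrW D p E₂ :=
    fun E₀ E₁ E₂ => by rw [sum_wt3W_phi2 p D a (ind (box E₀ E₁ E₂)), sum_wt3W_ind_box]
  have h2 : ∀ E₀ E₁ E₂ : Set (Finset (Sym2 V)),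
      ∑ x ∈ triples D, wt3W D p x * ind (box E₀ E₁ E₂) (phi2 c x) = PrW D p E₀ * PrW D p E₁ * PrW D p E₂ :=
    fun E₀ E₁ E₂ => by rw [sum_wt3W_phi2 p D c (ind (box E₀ E₁ E₂)), sum_wt3W_ind_box]
  have h3 : ∀ E₀ E₁ E₂ : Set (Finset (Sym2 V)),
      ∑ x ∈ triples D, wt3W D p x * ind (box E₀ E₁ E₂) (psi3 a c x) = PrW D p E₀ * PrW D p E₁ * PrW D p E₂ :=
    fun E₀ E₁ E₂ => by rw [sum_wt3W_psi3 p D a c (ind (box E₀ E₁ E₂)), sum_wt3W_ind_box]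
  have h4 : ∀ E₀ E₁ E₂ : Set (Finset (Sym2 V)),
      ∑ x ∈ triples D, wt3W D p x * ind (box E₀ E₁ E₂) (psi4 b c x) = PrW D p E₀ * PrW D p E₁ * PrW D p E₂ :=
    fun E₀ E₁ E₂ => by rw [sum_wt3W_psi4 p D b c (ind (box E₀ E₁ E₂)), sum_wt3W_ind_box]
  have h5 : ∀ E₀ E₁ E₂ : Set (Finset (Sym2 V)),
      ∑ x ∈ triples D, wt3W D p x * ind (box E₀ E₁ E₂) (phi3 c a x) = PrW D p E₀ * PrW D p E₁ * PrW D p E₂ :=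
    fun E₀ E₁ E₂ => by rw [sum_wt3W_phi3 p D c a (ind (box E₀ E₁ E₂)), sum_wt3W_ind_box]
  simp only [certI5, mul_add, mul_sub, mul_neg, Finset.sum_add_distrib, Finset.sum_sub_distrib,
    Finset.sum_neg_distrib, sum_wt3W_ind_box, h1, h2, h3, h4, h5]

end Expectation

/-! ### The theorem at the finitary level -/

section Main

variable {p : Sym2 V → ℝ} (hp0 : ∀ i, 0 ≤ p i) (hp1 : ∀ i, p i ≤ 1) (D : Finset (Sym2 V)) (a b c : V)
include hp0 hp1

/-- **`T_inc` at the finitary level.**  With `t = P(abc)`, `q = P(a|b|c)`, `u_c = P(ab|c)`, `u_b = P(ac|b)`, `u_a = P(bc|a)`: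
`(1 + q)(qt − (u_cu_b + u_cu_a + u_bu_a)) − u_cu_bu_a ≥ 0`.  Proof: `0 ≥ E[S] = −T_inc`. [this work] -/
theorem tInc_PrW :
    0 ≤ (1 + PrW D p ((conn a b)ᶜ ∩ ((conn a c)ᶜ ∩ (conn b c)ᶜ))) *
          (PrW D p ((conn a b)ᶜ ∩ ((conn a c)ᶜ ∩ (conn b c)ᶜ)) * PrW D p (conn a b ∩ conn a c) -
            (PrW D p (conn a b ∩ (conn a c)ᶜ) * PrW D p (conn a c ∩ (conn a b)ᶜ) +
              PrW D p (conn a b ∩ (conn a c)ᶜ) * PrW D p (conn b c ∩ (conn a b)ᶜ) +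
              PrW D p (conn a c ∩ (conn a b)ᶜ) * PrW D p (conn b c ∩ (conn a b)ᶜ))) -
        PrW D p (conn a b ∩ (conn a c)ᶜ) * PrW D p (conn a c ∩ (conn a b)ᶜ) *
          PrW D p (conn b c ∩ (conn a b)ᶜ) := by
  -- transitivity of connection, at the level of events
  have t1 : ∀ K : Finset (Sym2 V), K ∈ conn a c → K ∈ conn b c → K ∈ conn a b :=
    fun K hac hbc => mem_conn.2 ((mem_conn.1 hac).trans (mem_conn.1 hbc).symm)
  have t2 : ∀ K : Finset (Sym2 V), K ∈ conn a b → K ∈ conn b c → K ∈ conn a c :=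
    fun K hab hbc => mem_conn.2 ((mem_conn.1 hab).trans (mem_conn.1 hbc))
  have t3 : ∀ K : Finset (Sym2 V), K ∈ conn a b → K ∈ conn a c → K ∈ conn b c :=
    fun K hab hac => mem_conn.2 ((mem_conn.1 hab).symm.trans (mem_conn.1 hac))
  -- the linear relations among the events (cells: q, t, uc = ab|c, ub = ac|b, ua = bc|a)
  have R1 : PrW D p (conn a c ∩ (conn a b)ᶜ)ᶜ = 1 - PrW D p (conn a c ∩ (conn a b)ᶜ) := by
    have h := PrW_union D p (Set.disjoint_left.2 fun K (h1 : K ∈ conn a c ∩ (conn a b)ᶜ)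
      (h2 : K ∈ (conn a c ∩ (conn a b)ᶜ)ᶜ) => h2 h1)
    rw [Set.union_compl_self, PrW_univ] at h
    linarith
  have R2 : PrW D p ((conn a b)ᶜ ∩ (conn a c)ᶜ) =
      PrW D p ((conn a b)ᶜ ∩ ((conn a c)ᶜ ∩ (conn b c)ᶜ)) + PrW D p (conn b c ∩ (conn a b)ᶜ) := by
    rw [← PrW_union D p]
    · refine PrW_congr_set D p fun K _ => ?_
      simp only [Set.mem_union, Set.mem_inter_iff, Set.mem_compl_iff]
      have := t1 K; tauto
    · exact Set.disjoint_left.2 fun K h1 h2 => h1.2.2 h2.1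
  have R3 : PrW D p (conn a b)ᶜ = PrW D p ((conn a b)ᶜ ∩ ((conn a c)ᶜ ∩ (conn b c)ᶜ)) +
      PrW D p (conn b c ∩ (conn a b)ᶜ) + PrW D p (conn a c ∩ (conn a b)ᶜ) := by
    rw [← PrW_union D p, ← PrW_union D p]
    · refine PrW_congr_set D p fun K _ => ?_
      simp only [Set.mem_union, Set.mem_inter_iff, Set.mem_compl_iff]
      have := t1 K; tauto
    · exact Set.disjoint_left.2 fun K h1 h2 => by
        rcases h1 with h1 | h1
        · exact h1.2.1 h2.1
        · exact h1.2 (t1 K h2.1 h1.1)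
    · exact Set.disjoint_left.2 fun K h1 h2 => h1.2.2 h2.1
  have R4 : PrW D p ((conn a b)ᶜ ∩ (conn b c)ᶜ) =
      PrW D p ((conn a b)ᶜ ∩ ((conn a c)ᶜ ∩ (conn b c)ᶜ)) + PrW D p (conn a c ∩ (conn a b)ᶜ) := by
    rw [← PrW_union D p]
    · refine PrW_congr_set D p fun K _ => ?_
      simp only [Set.mem_union, Set.mem_inter_iff, Set.mem_compl_iff]
      have := t3 K; tauto
    · exact Set.disjoint_left.2 fun K h1 h2 => h1.2.1 h2.1
  have R5 : PrW D p (conn b c)ᶜ = PrW D p ((conn a b)ᶜ ∩ ((conn a c)ᶜ ∩ (conn b c)ᶜ)) +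
      PrW D p (conn a c ∩ (conn a b)ᶜ) + PrW D p (conn a b ∩ (conn a c)ᶜ) := by
    rw [← PrW_union D p, ← PrW_union D p]
    · refine PrW_congr_set D p fun K _ => ?_
      simp only [Set.mem_union, Set.mem_inter_iff, Set.mem_compl_iff]
      have := t1 K; have := t2 K; have := t3 K; tauto
    · exact Set.disjoint_left.2 fun K h1 h2 => by
        rcases h1 with h1 | h1
        · exact h1.1 h2.1
        · exact h1.2 h2.1
    · exact Set.disjoint_left.2 fun K h1 h2 => h1.2.1 h2.1
  have R6 : PrW D p (conn a b) = PrW D p (conn a b ∩ (conn a c)ᶜ) + PrW D p (conn a b ∩ conn a c) := by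
    rw [← PrW_union D p]
    · refine PrW_congr_set D p fun K _ => ?_
      simp only [Set.mem_union, Set.mem_inter_iff, Set.mem_compl_iff]
      tauto
    · exact Set.disjoint_left.2 fun K h1 h2 => h1.2 h2.2
  have R7 : PrW D p (conn b c) = PrW D p (conn b c ∩ (conn a b)ᶜ) + PrW D p (conn a b ∩ conn a c) := by
    rw [← PrW_union D p]
    · refine PrW_congr_set D p fun K _ => ?_
      simp only [Set.mem_union, Set.mem_inter_iff, Set.mem_compl_iff]
      have := t1 K; have := t2 K; have := t3 K; tauto
    · exact Set.disjoint_left.2 fun K h1 h2 => h1.2 (t1 K h2.2 (t3 K h2.1 h2.2))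
  have R8 : PrW D p (conn b c) + PrW D p (conn b c)ᶜ = 1 := by
    rw [← PrW_union D p, Set.union_compl_self, PrW_univ]
    exact Set.disjoint_left.2 fun K h1 h2 => h2 h1
  have hU : PrW D p (Set.univ : Set (Finset (Sym2 V))) = 1 := PrW_univ D p
  -- E[S] ≤ 0
  have hle : ∑ x ∈ triples D, wt3W D p x * certI5 a b c x ≤ 0 :=
    Finset.sum_nonpos fun x _ =>
      mul_nonpos_of_nonneg_of_nonpos (DTree3.wt3W_nonneg D hp0 hp1 x) (certI5_nonpos a b c x)
  rw [sum_wt3W_certI5, R1, R2, R3, R4, R5, R6, R7, hU] at hle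
  set q := PrW D p ((conn a b)ᶜ ∩ ((conn a c)ᶜ ∩ (conn b c)ᶜ))
  set t := PrW D p (conn a b ∩ conn a c)
  set uc := PrW D p (conn a b ∩ (conn a c)ᶜ)
  set ub := PrW D p (conn a c ∩ (conn a b)ᶜ)
  set ua := PrW D p (conn b c ∩ (conn a b)ᶜ)
  have hsum : q + ua + ub + uc + t = 1 := by linarith
  rw [cert_identity q ua ub uc t hsum] at hle
  linarith

end Main

end TIncSwitching

/-! ### The theorem for `prodBernoulli w` -/

namespace TIncSwitching

section Measure

open Finset Literature.Probability.Percolation Literature.Probability.Percolation.DecisionTree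
open Literature.Probability.Percolation.Gladkov
open MeasureTheory Literature.Probability.LatticeModels
open scoped Classical

variable {V : Type*} [Finite V]

/-- **THEOREM (`T_inc`, the five-cell form), every finite weighted graph.**  For `μ = prodBernoulli w` and vertices `a b c`, with
`t = μ(ab ∩ ac)`, `q = μ(a|b|c)`, `u₃ = μ(ab|c)`, `u₂ = μ(ac|b)`, `u₁ = μ(a|bc)`:  `0 ≤ (1 + q)(qt − (u₃u₂ + u₃u₁ + u₂u₁)) − u₃u₂u₁`. [this work] -/
theorem tInc_prodBernoulli (w : Sym2 V → unitInterval) (a b c : V) :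
    0 ≤ (1 + (prodBernoulli w).real ((openConn a b)ᶜ ∩ (openConn a c)ᶜ ∩ (openConn b c)ᶜ)) *
          ((prodBernoulli w).real ((openConn a b)ᶜ ∩ (openConn a c)ᶜ ∩ (openConn b c)ᶜ) *
              (prodBernoulli w).real (openConn a b ∩ openConn a c) -
            ((prodBernoulli w).real (openConn a b ∩ (openConn a c)ᶜ) *
                (prodBernoulli w).real (openConn a c ∩ (openConn a b)ᶜ) +
              (prodBernoulli w).real (openConn a b ∩ (openConn a c)ᶜ) *
                (prodBernoulli w).real (openConn b c ∩ (openConn a b)ᶜ) +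
              (prodBernoulli w).real (openConn a c ∩ (openConn a b)ᶜ) *
                (prodBernoulli w).real (openConn b c ∩ (openConn a b)ᶜ))) -
        (prodBernoulli w).real (openConn a b ∩ (openConn a c)ᶜ) *
          (prodBernoulli w).real (openConn a c ∩ (openConn a b)ᶜ) *
          (prodBernoulli w).real (openConn b c ∩ (openConn a b)ᶜ) := by
  obtain ⟨_instV⟩ := nonempty_fintype V
  have hp0 : ∀ e, 0 ≤ (w e : ℝ) := fun e => (w e).2.1
  have hp1 : ∀ e, (w e : ℝ) ≤ 1 := fun e => (w e).2.2
  have key := tInc_PrW (p := fun e => (w e : ℝ)) hp0 hp1 Finset.univ a b c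
  have hco : ∀ (S : Finset (Sym2 V)) (u v : V),
      (↑S : Set (Sym2 V)) ∈ openConn u v ↔ (openGraph (↑S : Set (Sym2 V))).Reachable u v :=
    fun _ _ _ => Iff.rfl
  have e1 : (prodBernoulli w).real (openConn a b ∩ openConn a c) =
      PrW Finset.univ (fun e => (w e : ℝ)) (conn a b ∩ conn a c) :=
    prodBernoulli_real_eq_PrW_univ w fun S => by simp only [Set.mem_inter_iff, mem_conn, hco]
  have e2 : (prodBernoulli w).real ((openConn a b)ᶜ ∩ (openConn a c)ᶜ ∩ (openConn b c)ᶜ) =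
      PrW Finset.univ (fun e => (w e : ℝ)) ((conn a b)ᶜ ∩ ((conn a c)ᶜ ∩ (conn b c)ᶜ)) :=
    prodBernoulli_real_eq_PrW_univ w fun S => by
      simp only [Set.mem_inter_iff, Set.mem_compl_iff, mem_conn, hco, and_assoc]
  have e3 : (prodBernoulli w).real (openConn a b ∩ (openConn a c)ᶜ) =
      PrW Finset.univ (fun e => (w e : ℝ)) (conn a b ∩ (conn a c)ᶜ) :=
    prodBernoulli_real_eq_PrW_univ w fun S => by simp only [Set.mem_inter_iff, Set.mem_compl_iff, mem_conn, hco]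
  have e4 : (prodBernoulli w).real (openConn a c ∩ (openConn a b)ᶜ) =
      PrW Finset.univ (fun e => (w e : ℝ)) (conn a c ∩ (conn a b)ᶜ) :=
    prodBernoulli_real_eq_PrW_univ w fun S => by simp only [Set.mem_inter_iff, Set.mem_compl_iff, mem_conn, hco]
  have e5 : (prodBernoulli w).real (openConn b c ∩ (openConn a b)ᶜ) =
      PrW Finset.univ (fun e => (w e : ℝ)) (conn b c ∩ (conn a b)ᶜ) :=
    prodBernoulli_real_eq_PrW_univ w fun S => by simp only [Set.mem_inter_iff, Set.mem_compl_iff, mem_conn, hco]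
  rw [e1, e2, e3, e4, e5]
  exact key

/-- **THEOREM (`T_inc`): Sahi's `C₃` / Kahn's Conjecture 5 for the three increasing events "`a` (resp. `b`, `c`) is joined to
another terminal", on EVERY finite weighted graph** — the increasing dual of 3PT-LB:
`0 ≤ E₃({a↔b}∪{a↔c}, {a↔b}∪{b↔c}, {a↔c}∪{b↔c})`. [this work] -/
theorem sahiE3_nonIsol_nonneg (w : Sym2 V → unitInterval) (a b c : V) :
    0 ≤ sahiE3 (prodBernoulli w) (openConn a b ∪ openConn a c) (openConn a b ∪ openConn b c)
        (openConn a c ∪ openConn b c) := by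
  rw [TIncRow.sahiE3_nonIsol_eq]
  exact tInc_prodBernoulli w a b c

/-- **`TIncRow` holds** (the named `Prop` of `…CoSunflowerRows`, recorded there as an open conjecture). [this work] -/
theorem tIncRow_holds : TIncRow := fun _ _ w a b c => sahiE3_nonIsol_nonneg w a b c

end Measure

end TIncSwitching

end Summit.CriticalPhenomena.PercolationContinuityZ3.Theorems

end
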